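import Mathlib
import Literature.Computability.AlgebraicComplexity.EntropyMajorisation
import Literature.MathematicalPhysics.KineticTheory.HardSphereTwoTimePressure
import Summits.AtomisticToContinuum.HydrodynamicLimit.Theorems.BoltzmannGreenKubo.Negative.Stationarity
import Summits.AtomisticToContinuum.HydrodynamicLimit.Theses.UGibbsSRBRigidity
import HarnessLib

/-!
# The entropy rate `h(Φ₁, P)` of a finite partition exists under the equilibrium Gibbs law
(helper toward the support item `EntropyPerParticle`, stmt-AtomisticToContinuum-9392, route
UGibbsSRBRigidity)

The item `Summit.AtomisticToContinuum.HydrodynamicLimit.Theses.UGibbsSRBRigidity.EntropyPerParticle`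
asks, for every hard-sphere flow `Φ` and the equilibrium local Gibbs law
`μ = localGibbsLaw σ 1 0 1 N Φ`, for a finite measurable partition `P` whose dynamical entropy
`h(Φ₁, P) = lim_n n⁻¹ H_μ(P ∨ Φ₁⁻¹P ∨ ⋯ ∨ Φ₁^{-(n-1)}P)` EXISTS and is `≥ c (N+1)^{4/3}`.
This file proves the EXISTENCE half in full generality and for the item's objects:

* `EntropyPerParticleRate.exists_tendsto_entropyRate` — for a probability measure `μ`, a
  measure-preserving map `T` and a finite measurable partition `P : Fin k → Set α`, the sequence
  `n⁻¹ ∑_{w : Fin n → Fin k} -μ(⋂_m T^{-m} P_{w m}) log μ(⋂_m T^{-m} P_{w m})` converges (Fekete's lemma on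
  the subadditive sequence `H_μ(P^{(n)})`, subadditivity of the Shannon entropy and invariance),
  to a limit `h` with `0 ≤ h ≤ H_μ(P) ≤ log k` (Walters 1982, Thm 4.9 / Cor. 4.9.1; [folklore]).
* `EntropyPerParticleRate.exists_tendsto_entropyRate_localGibbsLaw` — the specialisation to the
  item: `μ = localGibbsLaw σ 1 0 1 N Φ` (a probability measure for `σ ≤ 1/2`,
  `isProbabilityMeasure_localGibbsLaw_const`) and `T = Φ.flow 1` (measure preserving,
  `BoltzmannGreenKuboOrthMomentum.measurePreserving_flow_localGibbsLaw`), literally the sequence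
  displayed in `EntropyPerParticle`.

Consequently the content of the item is the VALUE of the limit (an `N`-uniform lower bound
`h ≥ c (N+1)^{4/3}` on the Kolmogorov–Sinai entropy of the hard-sphere gas, which by
`h ≤ log k` also forces `k ≥ exp (c (N+1)^{4/3})` cells).
prover-pitem-stmt-AtomisticToContinuum-9392-0.
-/

noncomputable section

namespace Summit.AtomisticToContinuum.HydrodynamicLimit.Theorems

open MeasureTheory Filter Topology Set Function
open Real (negMulLog)
open Literature.Analysis.FluidPDE Literature.MathematicalPhysics.KineticTheory
open Literature.Computability.AlgebraicComplexity (shannonEntropy shannonEntropy_def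
  shannonEntropy_le_shannonEntropy_fst_add_snd shannonEntropy_le_of_mem_stdSimplex)

namespace EntropyPerParticleRate

variable {α : Type*} [MeasurableSpace α]

/-! ## Cylinder cells `⋂_{m<n} T^{-m} P_{w m}` of a finite partition -/

omit [MeasurableSpace α] in
/-- The `n`-cells of a pairwise disjoint family are pairwise disjoint. [folklore] -/
theorem pairwise_disjoint_cells (T : α → α) {k : ℕ} {P : Fin k → Set α}
    (hPd : Pairwise (Disjoint on P)) (n : ℕ) :
    Pairwise (Disjoint on fun w : Fin n → Fin k => ⋂ m : Fin n, T^[m.val] ⁻¹' P (w m)) := by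
  intro w w' hww'
  obtain ⟨m, hm⟩ : ∃ m, w m ≠ w' m := by
    by_contra h
    push Not at h
    exact hww' (funext h)
  refine Set.disjoint_left.2 fun x hx hx' => ?_
  have h1 : T^[m.val] x ∈ P (w m) := Set.mem_iInter.1 hx m
  have h2 : T^[m.val] x ∈ P (w' m) := Set.mem_iInter.1 hx' m
  exact Set.disjoint_left.1 (hPd hm) h1 h2

omit [MeasurableSpace α] in
/-- The `n`-cells of a covering family cover. [folklore] -/
theorem iUnion_cells_eq_univ (T : α → α) {k : ℕ} {P : Fin k → Set α}
    (hPu : (⋃ i, P i) = univ) (n : ℕ) :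
    (⋃ w : Fin n → Fin k, ⋂ m : Fin n, T^[m.val] ⁻¹' P (w m)) = univ := by
  refine Set.eq_univ_of_forall fun x => ?_
  have hx : ∀ m : Fin n, ∃ i : Fin k, T^[m.val] x ∈ P i := fun m => by
    have : T^[m.val] x ∈ ⋃ i, P i := hPu ▸ Set.mem_univ _
    exact Set.mem_iUnion.1 this
  choose w hw using hx
  exact Set.mem_iUnion.2 ⟨w, Set.mem_iInter.2 hw⟩

/-- The `n`-cells of a measurable family under a measurable map are measurable. [folklore] -/
theorem measurableSet_cell {T : α → α} (hT : Measurable T) {k : ℕ} {P : Fin k → Set α}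
    (hPm : ∀ i, MeasurableSet (P i)) {n : ℕ} (w : Fin n → Fin k) :
    MeasurableSet (⋂ m : Fin n, T^[m.val] ⁻¹' P (w m)) :=
  MeasurableSet.iInter fun m => (hT.iterate m.val) (hPm (w m))

omit [MeasurableSpace α] in
/-- Splitting of an `(n+m)`-cell: `⋂_{j<n+m} T^{-j} P_{(u ++ v) j} = (⋂_{j<n} T^{-j} P_{u j}) ∩
T^{-n} (⋂_{i<m} T^{-i} P_{v i})`. [folklore] -/
theorem cell_append (T : α → α) {k : ℕ} (P : Fin k → Set α) {n m : ℕ} (u : Fin n → Fin k)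
    (v : Fin m → Fin k) :
    (⋂ j : Fin (n + m), T^[j.val] ⁻¹' P (Fin.append u v j)) =
      (⋂ j : Fin n, T^[j.val] ⁻¹' P (u j)) ∩ T^[n] ⁻¹' (⋂ i : Fin m, T^[i.val] ⁻¹' P (v i)) := by
  ext x
  simp only [Set.mem_inter_iff, Set.mem_iInter, Set.mem_preimage]
  constructor
  · intro h
    refine ⟨fun j => ?_, fun i => ?_⟩
    · have := h (Fin.castAdd m j)
      rwa [Fin.append_left, Fin.val_castAdd] at this
    · have := h (Fin.natAdd n i)
      rwa [Fin.append_right, Fin.val_natAdd, add_comm, Function.iterate_add_apply] at this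
  · rintro ⟨h1, h2⟩ j
    refine Fin.addCases (motive := fun j => T^[j.val] x ∈ P (Fin.append u v j)) (fun j => ?_)
      (fun i => ?_) j
    · rw [Fin.append_left, Fin.val_castAdd]
      exact h1 j
    · rw [Fin.append_right, Fin.val_natAdd, add_comm, Function.iterate_add_apply]
      exact h2 i

/-! ## Finite additivity over a finite measurable partition -/

/-- `∑_i μ(A ∩ Q_i) = μ(A)` for a finite measurable partition `Q` and a finite measure. [folklore] -/
theorem sum_measureReal_inter_partition {ι : Type*} [Fintype ι] (μ : Measure α)
    [IsFiniteMeasure μ] {Q : ι → Set α} (hQm : ∀ i, MeasurableSet (Q i))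
    (hQd : Pairwise (Disjoint on Q)) (hQu : (⋃ i, Q i) = univ) {A : Set α}
    (hA : MeasurableSet A) : ∑ i, μ.real (A ∩ Q i) = μ.real A := by
  rw [← measureReal_iUnion_fintype
    (fun i j hij => (hQd hij).mono inter_subset_right inter_subset_right)
    (fun i => hA.inter (hQm i)), ← Set.inter_iUnion, hQu, Set.inter_univ]

/-- `∑_i μ(Q_i ∩ A) = μ(A)` for a finite measurable partition `Q` and a finite measure. [folklore] -/
theorem sum_measureReal_partition_inter {ι : Type*} [Fintype ι] (μ : Measure α)
    [IsFiniteMeasure μ] {Q : ι → Set α} (hQm : ∀ i, MeasurableSet (Q i))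
    (hQd : Pairwise (Disjoint on Q)) (hQu : (⋃ i, Q i) = univ) {A : Set α}
    (hA : MeasurableSet A) : ∑ i, μ.real (Q i ∩ A) = μ.real A := by
  simp_rw [Set.inter_comm _ A]
  exact sum_measureReal_inter_partition μ hQm hQd hQu hA

/-! ## Subadditivity of `n ↦ H_μ(P^{(n)})` and Fekete -/

/-- **Subadditivity of the entropy of iterated partitions**: with
`H n = ∑_{w : Fin n → Fin k} η(μ(⋂_{m<n} T^{-m} P_{w m}))`, `η(x) = -x log x`, one has
`H (n + m) ≤ H n + H m` for a probability measure preserved by `T` (subadditivity of the Shannon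
entropy, `H(ξ ∨ T^{-n}ζ) ≤ H(ξ) + H(T^{-n}ζ) = H(ξ) + H(ζ)`; Walters 1982, Thm 4.3 (viii) and
Thm 4.9). [folklore] -/
theorem entropy_cells_subadditive (μ : Measure α) [IsProbabilityMeasure μ] {T : α → α}
    (hT : MeasurePreserving T μ μ) {k : ℕ} {P : Fin k → Set α} (hPm : ∀ i, MeasurableSet (P i))
    (hPd : Pairwise (Disjoint on P)) (hPu : (⋃ i, P i) = univ) :
    Subadditive fun n : ℕ => ∑ w : Fin n → Fin k,
      negMulLog (μ.real (⋂ m : Fin n, T^[m.val] ⁻¹' P (w m))) := by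
  intro n m
  -- notation-free abbreviations
  set A : (Fin n → Fin k) → Set α := fun u => ⋂ j : Fin n, T^[j.val] ⁻¹' P (u j) with hA
  set B : (Fin m → Fin k) → Set α := fun v => ⋂ i : Fin m, T^[i.val] ⁻¹' P (v i) with hB
  have hAm : ∀ u, MeasurableSet (A u) := fun u => measurableSet_cell hT.measurable hPm u
  have hBm : ∀ v, MeasurableSet (B v) := fun v => measurableSet_cell hT.measurable hPm v
  have hAd : Pairwise (Disjoint on A) := pairwise_disjoint_cells T hPd n
  have hBd : Pairwise (Disjoint on B) := pairwise_disjoint_cells T hPd m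
  have hAu : (⋃ u, A u) = univ := iUnion_cells_eq_univ T hPu n
  have hBu : (⋃ v, B v) = univ := iUnion_cells_eq_univ T hPu m
  -- the preimage partition `T^{-n} B`
  have hTn : MeasurePreserving T^[n] μ μ := hT.iterate n
  set B' : (Fin m → Fin k) → Set α := fun v => T^[n] ⁻¹' B v with hB'
  have hB'm : ∀ v, MeasurableSet (B' v) := fun v => hTn.measurable (hBm v)
  have hB'd : Pairwise (Disjoint on B') := fun v v' h => (hBd h).preimage _
  have hB'u : (⋃ v, B' v) = univ := by
    rw [hB', ← Set.preimage_iUnion, hBu, Set.preimage_univ]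
  -- the joint vector
  set J : (Fin n → Fin k) × (Fin m → Fin k) → ℝ := fun p => μ.real (A p.1 ∩ B' p.2) with hJ
  have hJ1 : ∀ u, ∑ v, J (u, v) = μ.real (A u) := fun u =>
    sum_measureReal_inter_partition μ hB'm hB'd hB'u (hAm u)
  have hJ2 : ∀ v, ∑ u, J (u, v) = μ.real (B v) := fun v => by
    have h := sum_measureReal_partition_inter μ hAm hAd hAu (hB'm v)
    simp only [hJ]
    rw [h, hB']
    simp only [measureReal_def]
    rw [hTn.measure_preimage (hBm v).nullMeasurableSet]
  have hJs : J ∈ stdSimplex ℝ ((Fin n → Fin k) × (Fin m → Fin k)) := by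
    refine ⟨fun p => measureReal_nonneg, ?_⟩
    rw [Fintype.sum_prod_type]
    simp_rw [hJ1]
    rw [← measureReal_iUnion_fintype hAd hAm, hAu, probReal_univ]
  -- rewrite `H (n + m)` through `Fin.appendEquiv`
  have hsplit : (∑ w : Fin (n + m) → Fin k,
      negMulLog (μ.real (⋂ j : Fin (n + m), T^[j.val] ⁻¹' P (w j)))) = ∑ p, negMulLog (J p) := by
    rw [← Fintype.sum_equiv (Fin.appendEquiv n m) (fun p => negMulLog (J p))
      (fun w => negMulLog (μ.real (⋂ j : Fin (n + m), T^[j.val] ⁻¹' P (w j))))]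
    intro p
    simp only [Fin.appendEquiv_apply, hJ, hA, hB', hB, cell_append]
  -- subadditivity of the Shannon entropy (in bits; clear the `log 2`)
  have hsub := shannonEntropy_le_shannonEntropy_fst_add_snd hJs
  have h2 : 0 < Real.log 2 := Real.log_pos one_lt_two
  rw [shannonEntropy_def, shannonEntropy_def, shannonEntropy_def, ← add_div,
    div_le_div_iff_of_pos_right h2] at hsub
  simp only [hJ1, hJ2] at hsub
  -- `hsub : ∑ p, η (J p) ≤ ∑ u, η (μ (A u)) + ∑ v, η (μ (B v))`
  show (∑ w : Fin (n + m) → Fin k, negMulLog (μ.real (⋂ j : Fin (n + m), T^[j.val] ⁻¹' P (w j))))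
    ≤ (∑ u : Fin n → Fin k, negMulLog (μ.real (⋂ j : Fin n, T^[j.val] ⁻¹' P (u j)))) +
      ∑ v : Fin m → Fin k, negMulLog (μ.real (⋂ i : Fin m, T^[i.val] ⁻¹' P (v i)))
  rw [hsplit]
  exact hsub

/-- The entropy of the `1`-cells is the entropy `H_μ(P) = ∑_i η(μ(P_i))` of the partition. [folklore] -/
theorem entropy_cells_one (μ : Measure α) (T : α → α) {k : ℕ} (P : Fin k → Set α) :
    (∑ w : Fin 1 → Fin k, negMulLog (μ.real (⋂ m : Fin 1, T^[m.val] ⁻¹' P (w m)))) =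
      ∑ i, negMulLog (μ.real (P i)) := by
  rw [← Fintype.sum_equiv (Equiv.funUnique (Fin 1) (Fin k)).symm
    (fun i => negMulLog (μ.real (P i)))
    (fun w => negMulLog (μ.real (⋂ m : Fin 1, T^[m.val] ⁻¹' P (w m))))]
  intro i
  congr 2
  ext x
  simp

/-- `H_μ(P) ≤ log k` for a finite measurable partition into `k` cells of a probability space
(Jensen). [folklore] -/
theorem entropy_partition_le_log (μ : Measure α) [IsProbabilityMeasure μ] {k : ℕ}
    {P : Fin k → Set α} (hPm : ∀ i, MeasurableSet (P i)) (hPd : Pairwise (Disjoint on P))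
    (hPu : (⋃ i, P i) = univ) : ∑ i, negMulLog (μ.real (P i)) ≤ Real.log k := by
  have hs : (fun i => μ.real (P i)) ∈ stdSimplex ℝ (Fin k) := by
    refine ⟨fun i => measureReal_nonneg, ?_⟩
    rw [← measureReal_iUnion_fintype hPd hPm, hPu, probReal_univ]
  have h := shannonEntropy_le_of_mem_stdSimplex hs
  have h2 : 0 < Real.log 2 := Real.log_pos one_lt_two
  rw [shannonEntropy_def, div_le_div_iff_of_pos_right h2, Fintype.card_fin] at h
  exact h

/-- **The entropy rate of a finite partition exists** (Fekete): for a probability measure `μ`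
preserved by `T` and a finite measurable partition `P`, the averaged entropies
`n⁻¹ ∑_w -μ(C_w) log μ(C_w)` of the `n`-cells `C_w = ⋂_{m<n} T^{-m} P_{w m}` converge to some
`h ∈ [0, H_μ(P)]`, `H_μ(P) = ∑_i -μ(P_i) log μ(P_i) ≤ log k` (Walters 1982, Thm 4.9, Cor. 4.9.1,
Thm 4.10). [folklore] -/
theorem exists_tendsto_entropyRate (μ : Measure α) [IsProbabilityMeasure μ] {T : α → α}
    (hT : MeasurePreserving T μ μ) {k : ℕ} {P : Fin k → Set α} (hPm : ∀ i, MeasurableSet (P i))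
    (hPd : Pairwise (Disjoint on P)) (hPu : (⋃ i, P i) = univ) :
    ∃ h : ℝ, 0 ≤ h ∧ h ≤ ∑ i, negMulLog (μ.real (P i)) ∧
      Tendsto (fun n : ℕ => (n : ℝ)⁻¹ * ∑ w : Fin n → Fin k,
        -(μ.real (⋂ m : Fin n, T^[m.val] ⁻¹' P (w m)) *
          Real.log (μ.real (⋂ m : Fin n, T^[m.val] ⁻¹' P (w m))))) atTop (𝓝 h) := by
  have hS := entropy_cells_subadditive μ hT hPm hPd hPu
  set H : ℕ → ℝ := fun n => ∑ w : Fin n → Fin k,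
    negMulLog (μ.real (⋂ m : Fin n, T^[m.val] ⁻¹' P (w m))) with hH
  have hH0 : ∀ n, 0 ≤ H n := fun n =>
    Finset.sum_nonneg fun w _ => Real.negMulLog_nonneg measureReal_nonneg measureReal_le_one
  have hbdd : BddBelow (range fun n => H n / n) :=
    ⟨0, by rintro _ ⟨n, rfl⟩; exact div_nonneg (hH0 n) n.cast_nonneg⟩
  have hlim := hS.tendsto_lim hbdd
  refine ⟨hS.lim, ?_, ?_, ?_⟩
  · exact ge_of_tendsto' hlim fun n => div_nonneg (hH0 n) n.cast_nonneg
  · have h1 := hS.lim_le_div hbdd one_ne_zero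
    rw [Nat.cast_one, div_one] at h1
    refine h1.trans (le_of_eq ?_)
    exact entropy_cells_one μ T P
  · refine hlim.congr fun n => ?_
    rw [div_eq_inv_mul]
    congr 1
    refine Finset.sum_congr rfl fun w _ => ?_
    rw [Real.negMulLog, neg_mul]

/-! ## The item's objects: the equilibrium Gibbs law and the time-one map of a hard-sphere flow -/

/-- **Existence of the entropy rate in `EntropyPerParticle`.** For `σ ≤ 1/2`, every `N`, every
hard-sphere flow `Φ` of `N + 1` spheres of diameter `σ (N+1)^{-1/3}` on `𝕋³` and every finite
measurable partition `P` of phase space, the sequence displayed in the item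
`EntropyPerParticle` — `n⁻¹ ∑_{w : Fin n → Fin k} -μ(C_w) log μ(C_w)` with
`μ = localGibbsLaw σ 1 0 1 N Φ` the equilibrium Gibbs law (a probability measure, invariant under
`Φ₁ = Φ.flow 1`) and `C_w = ⋂_{m<n} (Φ₁^m)⁻¹ P_{w m}` — converges, to a limit
`h ∈ [0, H_μ(P)] ⊆ [0, log k]`. Hence the item's content is the lower bound on the VALUE of `h`
(and any witnessing partition needs `k ≥ exp (c (N+1)^{4/3})` cells). [folklore] -/
theorem exists_tendsto_entropyRate_localGibbsLaw {σ : ℝ} (hσ : σ ≤ 1 / 2) (N : ℕ)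
    (Φ : HardSphereFlow (Torus.geometry (Fin 3)) (hsDiameter σ N) (N + 1)) {k : ℕ}
    {P : Fin k → Set (Config (N + 1) (Fin 3) T3)} (hPm : ∀ i, MeasurableSet (P i))
    (hPd : Pairwise (Disjoint on P)) (hPu : (⋃ i, P i) = univ) :
    ∃ h : ℝ, 0 ≤ h ∧
      h ≤ ∑ i, negMulLog ((localGibbsLaw σ (fun _ => 1) (fun _ => 0) (fun _ => 1) N Φ).real (P i)) ∧
      (∑ i, negMulLog ((localGibbsLaw σ (fun _ => 1) (fun _ => 0) (fun _ => 1) N Φ).real (P i))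
        ≤ Real.log k) ∧
      Tendsto (fun n : ℕ => (n : ℝ)⁻¹ * ∑ w : Fin n → Fin k,
        -((localGibbsLaw σ (fun _ => 1) (fun _ => 0) (fun _ => 1) N Φ).real
            (⋂ m : Fin n, (Φ.flow 1)^[m.val] ⁻¹' P (w m)) *
          Real.log ((localGibbsLaw σ (fun _ => 1) (fun _ => 0) (fun _ => 1) N Φ).real
            (⋂ m : Fin n, (Φ.flow 1)^[m.val] ⁻¹' P (w m))))) atTop (𝓝 h) := by
  haveI := isProbabilityMeasure_localGibbsLaw_const one_pos hσ (0 : V3) N Φ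
  have hT := BoltzmannGreenKuboOrthMomentum.measurePreserving_flow_localGibbsLaw (σ := σ) 1 1
    (0 : V3) Φ 1
  obtain ⟨h, h0, h1, ht⟩ := exists_tendsto_entropyRate _ hT hPm hPd hPu
  exact ⟨h, h0, h1, entropy_partition_le_log _ hPm hPd hPu, ht⟩

end EntropyPerParticleRate

end Summit.AtomisticToContinuum.HydrodynamicLimit.Theorems

end
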